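import Summits.CriticalPhenomena.SAWScalingLimit.Theorems.CriticalBubbleBound.Negative.CriticalBubbleBoundIdleHypotheses
import Summits.CriticalPhenomena.SAWScalingLimit.Theorems.CriticalBubbleBound.Negative.CriticalBubbleBoundSufficient
import Literature.Barriers.CriticalPhenomena.LaceExpansionMeanFieldProofs

/-!
# Negative-side results for the crux `SAWTotalPositivity.CriticalBubbleBound` (stmt-CriticalPhenomena-7117):
the crux in the BARRIER CATALOGUE's vocabulary (`twoPointENN`, `bubbleDiagram`, `BubbleCondition` of
`Literature/Barriers/CriticalPhenomena/LaceExpansionMeanField*.lean`) and the ℓ²-STRENGTHENING: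
the bubble CONDITION `B(z_c) = Σ_x G_{z_c}(x)² < ∞`, which implies the crux and is the output of the
only technique that has proved finiteness of a critical BULK two-point function of a SAW model
(lace expansion: nearest-neighbour `d ≥ 5`, spread-out `d > 4`; the parafermionic observable on the
hexagonal lattice bounds only BOUNDARY/half-plane quantities — arches, bridges — cf. work-file §9a(3)),
is FALSE on `ℤ²` — a tree THEOREM (`bubbleDiagram_two_eq_top`). Typed hierarchy
`ℓ¹ = ∞ (§6) · ℓ² = ∞ (here) · ℓ^∞ open (§3) · nearest neighbour = the crux` (work-file §15).

Refuter `cdisprove` (standing adversary); the full indexed work file is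
`Summits/CriticalPhenomena/SAWScalingLimit/Cruxes/CriticalBubbleBound/Disproof.lean`.
-/

noncomputable section

open MeasureTheory Filter Topology Set Function
open Literature.Probability.LatticeModels
open Literature.Probability.RandomPlanarGeometry Literature.Probability.RandomPlanarGeometry.SAW
open scoped ENNReal NNReal BigOperators

namespace Summit.CriticalPhenomena.SAWScalingLimit.Theorems.CriticalBubbleBound.Negative

open Summit.CriticalPhenomena.SAWScalingLimit.Theses.SAWTotalPositivity (CriticalBubbleBound)
open Literature.Barriers.CriticalPhenomena (twoPointENN bubbleDiagram BubbleCondition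
  bubbleDiagram_two_eq_top not_bubbleCondition_two)

/-! ## §15 Barrier reduction: the crux in the catalogue's vocabulary; the ℓ²-strengthening
(bubble CONDITION) is FALSE on `ℤ²` -/

/-- The catalogue's `G_z(x) = Σ_n c_n(x) zⁿ ∈ [0,∞]` IS the lattice kernel `K_z(0,x)` (`z ≥ 0`).
[cite: Slade2006LaceExpansion, §2.1, eq. (2.18)] -/
theorem twoPointENN_two_eq_latticeKernel {z : ℝ} (hz : 0 ≤ z) (x : Site 2) :
    twoPointENN 2 z x = latticeKernel z 0 x := by
  rw [latticeKernel_zero_eq_tsum_countAt, twoPointENN]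
  exact tsum_congr fun n => by rw [ENNReal.ofReal_pow hz]

/-- The critical bubble at `e` is the catalogue's `G_{z_c}(e)` (`criticalPoint 2 = criticalFugacity`
definitionally). [cite: MadrasSlade1993, §1.4] -/
theorem bubble_eq_twoPointENN (e : Site 2) : bubble e = twoPointENN 2 (Zd.criticalPoint 2) e := by
  rw [bubble, Zd.criticalPoint_two, twoPointENN_two_eq_latticeKernel criticalFugacity_pos_lt_one'.1.le]

/-- **CATALOGUE FORM OF THE CRUX**: `CriticalBubbleBound ⟺ ∀ e ∼ 0, G_{z_c}(e) < ∞` with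
`G = Literature.Barriers.CriticalPhenomena.twoPointENN 2 (criticalPoint 2)` — verbatim the
quantity of which Madras–Slade (p. 18/37) say "it has not yet been proved rigorously that
`G_{z_c}(0,x)` is even finite for `d = 2, 3` or `4`", and of which the catalogue's docstring says
"finiteness of `G_{z_c}(x)` is open for `d ≤ 4`". [cite: MadrasSlade1993, §1.4] -/
theorem criticalBubbleBound_iff_twoPointENN_lt_top :
    CriticalBubbleBound ↔
      ∀ e : Site 2, (zdGraph 2).Adj 0 e → twoPointENN 2 (Zd.criticalPoint 2) e < ⊤ := by
  rw [criticalBubbleBound_iff_bubble_ne_top]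
  refine forall₂_congr fun e _ => ?_
  rw [bubble_eq_twoPointENN, lt_top_iff_ne_top]

/-- Dropping `u ∼ v` (§3) in catalogue form: `sup_x G_{z_c}(x) < ∞`. [cite: MadrasSlade1993, §1.4] -/
theorem criticalBubbleBoundWithoutAdj_iff_twoPointENN :
    CriticalBubbleBoundWithoutAdj ↔
      ∃ C : ℝ≥0∞, C ≠ ⊤ ∧ ∀ x : Site 2, twoPointENN 2 (Zd.criticalPoint 2) x ≤ C := by
  rw [criticalBubbleBoundWithoutAdj_iff]
  simp only [Zd.criticalPoint_two, twoPointENN_two_eq_latticeKernel criticalFugacity_pos_lt_one'.1.le]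

/-- `G_{z_c}(e)² ≤ B(z_c) = Σ_x G_{z_c}(x)²`. [cite: Slade2006LaceExpansion, §2.2, eq. (2.30)] -/
theorem bubble_sq_le_bubbleDiagram (e : Site 2) : bubble e ^ 2 ≤ bubbleDiagram 2 (Zd.criticalPoint 2) := by
  rw [bubble_eq_twoPointENN, bubbleDiagram]
  exact ENNReal.le_tsum e

/-- **THE ℓ²-STRENGTHENING IMPLIES THE CRUX …** The bubble CONDITION `B(z_c) < ∞` — the
hypothesis under which the lace expansion / Theorem 2.3 of Slade 2006 deliver mean-field behaviour,
and a THEOREM for `d ≥ 5` (Hara–Slade), where it is how `G_{z_c}(0,e) < ∞` is known — gives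
`CriticalBubbleBound` at once (`G(e)² ≤ B`) **… AND IS FALSE ON `ℤ²`**: the tree theorem
`Literature.Barriers.CriticalPhenomena.not_bubbleCondition_two` (from the Lieb–Simon critical
sphere bound `Σ_{‖y‖∞ = R} G_{z_c}(y) ≥ 1`, Cauchy–Schwarz on the `8R` sites of the sphere and
`Σ 1/R = ∞`). So this implication is void in the plane: the bubble-condition / small-bubble
lace-expansion route — the only one that has ever proved finiteness of a critical BULK two-point
function of a SAW model (`d ≥ 5`; on the hexagonal lattice the parafermionic observable bounds only
boundary/half-plane quantities, §9a(3)) — CANNOT reach this crux; a proof needs an input bounding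
the single number `G_{z_c}(e₀)` without square-summability. [cite: MadrasSlade1993, Definition 1.5.1 and §1.5 p. 22] -/
theorem criticalBubbleBound_of_bubbleCondition (h : BubbleCondition 2) : CriticalBubbleBound := by
  rw [criticalBubbleBound_iff_bubble_ne_top]
  intro e _ htop
  have h2 : bubble e ^ 2 ≠ ⊤ := ne_top_of_le_ne_top h.ne (bubble_sq_le_bubbleDiagram e)
  rw [htop, ENNReal.top_pow two_ne_zero] at h2
  exact h2 rfl

/-- **ℓ² = ∞ in the crux's own vocabulary**: `Σ_{x ∈ ℤ²} K_{x_c}(0,x)² = ∞`. With §6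
(`Σ_x K_{x_c}(0,x) ≥ χ(x_c) = ∞`, ℓ¹) and §3 (`sup_x K_{x_c}(0,x) < ∞`, ℓ^∞, open, believed
true) the crux `K_{x_c}(0,e₀) < ∞` is the WEAKEST statement of the chain
`ℓ¹ ⊂ ℓ² ⊂ ℓ^∞ ⊂ {value at e₀}`, and the first two are false. [cite: MadrasSlade1993, §1.5 p. 22 and Lemma A.1] -/
theorem tsum_bubble_sq_eq_top : ∑' x : Site 2, bubble x ^ 2 = ⊤ := by
  have h := bubbleDiagram_two_eq_top
  rw [bubbleDiagram] at h
  simpa only [bubble_eq_twoPointENN] using h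

/-- The critical sphere bound in the crux's vocabulary: `Σ_{‖y‖∞ = R} K_{x_c}(0,y) ≥ 1` for every
`R ≥ 1` — the critical two-point function is not summably small on spheres (whence `χ(x_c) = ∞`
and `B(x_c) = ∞`), while nothing follows for the bounded quantities `sup_x K` and `K(0,e₀)`.
[cite: MadrasSlade1993, Lemma A.1 and eq. (6.5.8)] -/
theorem one_le_sum_sphere_bubble {R : ℕ} (hR : 1 ≤ R) :
    (1 : ℝ≥0∞) ≤ ∑ y ∈ Literature.Probability.LatticeModels.sphere 2 R, bubble y := by
  simpa only [bubble_eq_twoPointENN] using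
    Literature.Barriers.CriticalPhenomena.one_le_sphereSum_twoPointENN 2 hR

end Summit.CriticalPhenomena.SAWScalingLimit.Theorems.CriticalBubbleBound.Negative
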